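import Summits.Ventures.LatticeQCDFlow.Scaling.ConveyorRotation
import Literature.NumberTheory.Sieve.MatomakiRadziwillTheorem3

/-!
HONEST FRAMING: exact (Metropolis-corrected) sampling algorithms for lattice gauge theory; figures
of merit are autocorrelation/cost numbers at stated couplings and volumes; no continuum-physics
claim.

# ConveyorPoincareHeating — THE `q`-FREE CONVEYOR POINCARÉ INEQUALITY: HEATING PERSISTENCE `p` AND THE
# ONE-LEVEL BLOCK-HEATING FACTOR `U` GIVE `Gap ≥ (p/(16(K+1)))·min{κ/(KU), ρθ}` (lean-2 GEN-18, ours)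

Venture-side (OURS).  Cell `lqcd-flow` (pub-lqcd), unit `pub-lqcd-lean-2-g18`, 2026-08-25.  Fifth file of chapter C;
assembles `Scaling/ConveyorRotation` (rotation arm + source) with Efron–Stein (`Scaling/ConveyorLadder`) exactly
as `Scaling/ConveyorPoincare` assembled the bubbling legs — but along the ROTATION PATH of length `2k+1` for the
label of level `k = j+1`: relabel the hot position `a ↦ v`, ride `v` down to level `k` (`insertNth t v r`,
`t = 0..k`), which leaves the old label `o = r j` at level `j` inserted into `r̂ = update r j v`
(`insertNth (j+1) v r = insertNth j o r̂`), ride `o` up (`insertNth t o r̂`, `t = j..0`), relabel `o ↦ a`.  The two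
rides are `rotation_arm_le` (the second after the measure-preserving involution `(r, v) ↦ (r̂, o)`), the two
relabels are `rotation_source_le` (the second after the same involution); level `0` is a single relabel.

## What is proved

* **`conveyor_poincare_rot`** — with transposition flows `ν⊗(z)Q(z,z∘σ_l) ≥ κ·min{ν⊗(z), ν⊗(z∘σ_l)}`, a `ν_0`-chain
  `Q₀` of Poincaré constant `ρ` dominated `θ×` at the hot position, heating persistence `p·ν_k ≤ ν_i` (`i ≤ k`) and
  the block-heating factor `Π_iν_{i+1}(r_i) ≤ U·Π_iν_{t.succAbove i}(r_i)`:
  **`C·Var_{ν⊗}(f) ≤ 𝓔_{ν⊗}(Q; f)` whenever `0 ≤ C`, `C·16K(K+1)U ≤ pκ`, `C·16(K+1) ≤ pρθ`.**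
* **`conveyor_poincare_of_growth`** — the same with `U = M^K` under one-level growth `ν_{l+1}(j) ≤ M·ν_l(j)`, `1 ≤ M`;
  `prod_succ_le_levelGrowth` / **`conveyor_poincare_of_levelGrowth`** — `U = Π_l M_l` under levelwise growth
  `ν_{l+1}(j) ≤ M_l·ν_l(j)`.  Labels that only DECAY towards the cold end contribute nothing to `M_l`: the constant
  carries no trace of how rare they become — compare `conveyor_poincare_of_cooling`, whose `q^K` is their full decay.

NOT CLAIMED: the chapter-R consequences (a `U`-form of `Scaling/ReplicaExchangeModeGap` is the successor's file);
optimality of the constants.  Literature grade (cell rule): KNOWN MECHANISM (comparison paths), NEW RESULT for this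
chain; nothing cited as a fact; no new bib keys.
-/

noncomputable section

open Finset Function
open Literature.Probability.MarkovChains

namespace Summit.Ventures.LatticeQCDFlow.Scaling

section Rotation

variable {J : Type*} [Fintype J] [DecidableEq J] {K : ℕ} {ν : Fin (K + 1) → J → ℝ}
  {Q : Matrix (Fin (K + 1) → J) (Fin (K + 1) → J) ℝ}

omit [Fintype J] [DecidableEq J] in
/-- **Levelwise growth gives the block-heating factor `U = Π_l M_l`:** if `ν_{l+1}(j) ≤ M_l·ν_l(j)` (`1 ≤ M_l`, `ν ≥ 0`)
then `Π_i ν_{i+1}(r_i) ≤ (Π_l M_l)·Π_i ν_{t.succAbove i}(r_i)` for every `t`. [ours] -/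
theorem prod_succ_le_levelGrowth (hν0 : ∀ k j, 0 ≤ ν k j) {Mg : Fin K → ℝ} (hM1 : ∀ l, 1 ≤ Mg l)
    (hM : ∀ (l : Fin K) (j : J), ν l.succ j ≤ Mg l * ν l.castSucc j) (t : Fin (K + 1)) (r : Fin K → J) :
    ∏ i, ν i.succ (r i) ≤ (∏ l, Mg l) * ∏ i, ν (t.succAbove i) (r i) := by
  have h1 : ∏ i, ν i.succ (r i) ≤ ∏ i : Fin K, (Mg i * ν (t.succAbove i) (r i)) := by
    refine prod_le_prod (fun i _ => hν0 _ _) fun i _ => ?_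
    by_cases hi : i.castSucc < t
    · rw [Fin.succAbove_of_castSucc_lt _ _ hi]; exact hM i (r i)
    · rw [Fin.succAbove_of_le_castSucc _ _ (not_lt.mp hi)]
      exact le_mul_of_one_le_left (hν0 _ _) (hM1 i)
  rw [prod_mul_distrib] at h1
  exact h1

/-- **THE `q`-FREE CONVEYOR POINCARÉ INEQUALITY.**  Let `Q ≥ 0` be a chain on `Fin (K+1) → J` and `ν_k ≥ 0`
probability vectors with: transposition flows `ν⊗(z)Q(z, z∘σ_l) ≥ κ·min{ν⊗(z), ν⊗(z∘σ_l)}`; a `ν_0`-chain `Q₀` with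
`ρ·Var_{ν_0} ≤ 𝓔_{ν_0}(Q₀)` dominated at the hot position, `θ·ν⊗(z)Q₀(z_0,v) ≤ ν⊗(z)Q(z, update z 0 v)` (`v ≠ z_0`);
heating persistence `p·ν_k(j) ≤ ν_i(j)` (`i ≤ k`) and a block-heating factor `U > 0`,
`Π_iν_{i+1}(r_i) ≤ U·Π_iν_{t.succAbove i}(r_i)` for all `t`, `r`.  Then **`C·Var_{ν⊗}(f) ≤ 𝓔_{ν⊗}(Q; f)` for every `f`
and every `C ≥ 0` with `C·16K(K+1)U ≤ pκ` and `C·16(K+1) ≤ pρθ`.** [ours] -/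
theorem conveyor_poincare_rot (hν0 : ∀ k j, 0 ≤ ν k j) (hν1 : ∀ k, ∑ j, ν k j = 1) {p U κ ρ θ : ℝ}
    (hp : 0 < p) (hU : 0 < U) (hκ : 0 < κ) (hρ : 0 < ρ) (hθ : 0 < θ)
    (hpers : ∀ (i k : Fin (K + 1)) (j : J), i ≤ k → p * ν k j ≤ ν i j)
    (hgrow : ∀ (t : Fin (K + 1)) (r : Fin K → J), ∏ i, ν i.succ (r i) ≤ U * ∏ i, ν (t.succAbove i) (r i))
    (hQ0 : ∀ z y, 0 ≤ Q z y)
    (hT : ∀ (z : Fin (K + 1) → J) (l : Fin K), z ∘ Equiv.swap l.castSucc l.succ ≠ z →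
      κ * min (tensorFun ν z) (tensorFun ν (z ∘ Equiv.swap l.castSucc l.succ))
        ≤ tensorFun ν z * Q z (z ∘ Equiv.swap l.castSucc l.succ))
    {Q₀ : Matrix J J ℝ} (hρvar : ∀ h : J → ℝ, ρ * lawVariance (ν 0) h ≤ dirichletForm (ν 0) Q₀ h)
    (hR : ∀ (z : Fin (K + 1) → J) (v : J), v ≠ z 0 →
      θ * (tensorFun ν z * Q₀ (z 0) v) ≤ tensorFun ν z * Q z (update z 0 v))
    (f : (Fin (K + 1) → J) → ℝ) {C : ℝ} (hC0 : 0 ≤ C) (hC1 : C * (16 * K * (K + 1) * U) ≤ p * κ)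
    (hC2 : C * (16 * (K + 1)) ≤ p * ρ * θ) :
    C * lawVariance (tensorFun ν) f ≤ dirichletForm (tensorFun ν) Q f := by
  have hW0 : ∀ z, 0 ≤ tensorFun ν z := fun z => prod_nonneg fun i _ => hν0 _ _
  -- the kept quantities
  set T : ℝ := ∑ l : Fin K, ∑ w : Fin (K + 1) → J, tensorFun ν w * Q w (w ∘ Equiv.swap l.castSucc l.succ)
    * (f w - f (w ∘ Equiv.swap l.castSucc l.succ)) ^ 2 with hTdef
  set R : ℝ := (1 / 2) * ∑ z : Fin (K + 1) → J, ∑ v,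
    tensorFun ν z * Q z (update z 0 v) * (f z - f (update z 0 v)) ^ 2 with hRdef
  have hTle : (1 / 2) * T ≤ dirichletForm (tensorFun ν) Q f :=
    half_sum_transposition_le_dirichletForm hW0 hQ0 f
  have hRle : R ≤ dirichletForm (tensorFun ν) Q f := half_sum_relabel_le_dirichletForm hW0 hQ0 f
  have hT0 : 0 ≤ T := sum_nonneg fun l _ => sum_nonneg fun w _ =>
    mul_nonneg (mul_nonneg (hW0 w) (hQ0 _ _)) (sq_nonneg _)
  have hR0 : 0 ≤ R := mul_nonneg (by norm_num) (sum_nonneg fun z _ => sum_nonneg fun v _ =>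
    mul_nonneg (mul_nonneg (hW0 z) (hQ0 _ _)) (sq_nonneg _))
  have hpκ : 0 < p * κ := mul_pos hp hκ
  have hall : 0 < p * ρ * θ := by positivity
  -- the block weight of levels `1..K`, the source and arm quantities
  set Tl : (Fin K → J) → ℝ := fun r => ∏ i, ν i.succ (r i) with hTl
  have hTl0 : ∀ r, 0 ≤ Tl r := fun r => prod_nonneg fun i _ => hν0 _ _
  set S : Fin (K + 1) → ℝ := fun k => ∑ r : Fin K → J, ∑ a : J, ∑ v : J, ν 0 a * Tl r * ν k v
    * (f (Fin.insertNth 0 a r) - f (Fin.insertNth 0 v r)) ^ 2 with hSdef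
  set A : Fin (K + 1) → Fin (K + 1) → ℝ := fun m k => ∑ r : Fin K → J, ∑ v : J, Tl r * ν k v
    * (f (Fin.insertNth 0 v r) - f (Fin.insertNth m v r)) ^ 2 with hAdef
  have hS : ∀ k, S k ≤ 2 / (p * ρ * θ) * R := fun k =>
    rotation_source_le hν0 hν1 hp hρ hθ hpers hρvar hR f k
  have hA : ∀ m k : Fin (K + 1), m ≤ k → A m k ≤ (m : ℝ) * U / (p * κ) * T := fun m k hmk =>
    rotation_arm_le hν0 hp hU hκ hpers hgrow hQ0 hT f hmk
  have hAK : ∀ m k : Fin (K + 1), m ≤ k → A m k ≤ (K : ℝ) * U / (p * κ) * T := by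
    intro m k hmk
    refine le_trans (hA m k hmk) (mul_le_mul_of_nonneg_right ?_ hT0)
    refine div_le_div_of_nonneg_right (mul_le_mul_of_nonneg_right ?_ hU.le) hpκ.le
    exact_mod_cast Fin.is_le m
  -- separating out the hot coordinate
  have hre : ∀ G : (Fin (K + 1) → J) → ℝ,
      ∑ z : Fin (K + 1) → J, G z = ∑ r : Fin K → J, ∑ a : J, G (Fin.insertNth 0 a r) := by
    intro G
    rw [← Equiv.sum_comp (Fin.insertNthEquiv (fun _ => J) 0) G, Fintype.sum_prod_type, sum_comm]
    simp [Fin.insertNthEquiv]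
  have hE : ∀ k : Fin (K + 1), ∑ z : Fin (K + 1) → J, ∑ v, tensorFun ν z * ν k v * (f z - f (update z k v)) ^ 2
      = ∑ r : Fin K → J, ∑ a : J, ∑ v : J, ν 0 a * Tl r * ν k v
          * (f (Fin.insertNth 0 a r) - f (update (Fin.insertNth 0 a r : Fin (K + 1) → J) k v)) ^ 2 := by
    intro k
    rw [hre]
    refine sum_congr rfl fun r _ => sum_congr rfl fun a _ => sum_congr rfl fun v _ => ?_
    rw [tensorFun_insertNth]
    simp [hTl]
  -- the per-level bound
  have hk : ∀ k : Fin (K + 1), (1 / 2) * ∑ z : Fin (K + 1) → J, ∑ v,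
      tensorFun ν z * ν k v * (f z - f (update z k v)) ^ 2
        ≤ 8 / (p * ρ * θ) * R + 4 * K * U / (p * κ) * T := by
    intro k
    rw [hE k]
    have hKT : 0 ≤ 4 * K * U / (p * κ) * T := by positivity
    rcases Fin.eq_zero_or_eq_succ k with rfl | ⟨j, rfl⟩
    · -- level `0`: a single relabel
      have e0 : ∑ r : Fin K → J, ∑ a : J, ∑ v : J, ν 0 a * Tl r * ν 0 v
          * (f (Fin.insertNth 0 a r) - f (update (Fin.insertNth 0 a r : Fin (K + 1) → J) 0 v)) ^ 2 = S 0 := by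
        simp only [hSdef, Fin.update_insertNth]
      rw [e0]
      have h1 : (1 / 2) * S 0 ≤ 1 / (p * ρ * θ) * R := by
        have := hS 0
        have e : 1 / (p * ρ * θ) * R = (1 / 2) * (2 / (p * ρ * θ) * R) := by ring
        rw [e]; exact mul_le_mul_of_nonneg_left this (by norm_num)
      have h2 : 1 / (p * ρ * θ) * R ≤ 8 / (p * ρ * θ) * R :=
        mul_le_mul_of_nonneg_right (div_le_div_of_nonneg_right (by norm_num) hall.le) hR0
      linarith
    · -- level `j+1`: the rotation
      have hu : ∀ (a : J) (r : Fin K → J) (v : J),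
          update (Fin.insertNth 0 a r : Fin (K + 1) → J) j.succ v = Fin.insertNth 0 a (update r j v) := by
        intro a r v
        have h := Fin.insertNth_update (α := fun _ : Fin (K + 1) => J) 0 a j v r
        simp only [Fin.succAbove_zero] at h
        exact h.symm
      have hrot : ∀ (r : Fin K → J) (v : J), (Fin.insertNth j.succ v r : Fin (K + 1) → J)
          = Fin.insertNth j.castSucc (r j) (update r j v) :=
        fun r v => insertNth_succ_eq_insertNth_castSucc_update j v r
      -- the block weight is invariant under the involution `(r, v) ↦ (update r j v, r j)`
      have hwid : ∀ (r : Fin K → J) (v : J), Tl r * ν j.succ v = Tl (update r j v) * ν j.succ (r j) := by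
        intro r v
        simp only [hTl]
        rw [← mul_prod_erase univ (fun i => ν i.succ (r i)) (mem_univ j),
          ← mul_prod_erase univ (fun i => ν i.succ (update r j v i)) (mem_univ j)]
        have e : ∏ i ∈ univ.erase j, ν i.succ (update r j v i) = ∏ i ∈ univ.erase j, ν i.succ (r i) :=
          prod_congr rfl fun i hi => by rw [update_of_ne (ne_of_mem_erase hi)]
        rw [e, update_self]
        ring
      -- the four legs, pointwise
      have hpt : ∀ (r : Fin K → J) (a v : J), ν 0 a * Tl r * ν j.succ v
          * (f (Fin.insertNth 0 a r) - f (update (Fin.insertNth 0 a r : Fin (K + 1) → J) j.succ v)) ^ 2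
          ≤ 4 * (ν 0 a * Tl r * ν j.succ v * (f (Fin.insertNth 0 a r) - f (Fin.insertNth 0 v r)) ^ 2)
            + 4 * (ν 0 a * Tl r * ν j.succ v
              * (f (Fin.insertNth 0 v r) - f (Fin.insertNth j.succ v r)) ^ 2)
            + 4 * (ν 0 a * Tl r * ν j.succ v
              * (f (Fin.insertNth j.castSucc (r j) (update r j v))
                - f (Fin.insertNth 0 (r j) (update r j v))) ^ 2)
            + 4 * (ν 0 a * Tl r * ν j.succ v
              * (f (Fin.insertNth 0 (r j) (update r j v)) - f (Fin.insertNth 0 a (update r j v))) ^ 2) := by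
        intro r a v
        have hw : 0 ≤ ν 0 a * Tl r * ν j.succ v := mul_nonneg (mul_nonneg (hν0 _ _) (hTl0 r)) (hν0 _ _)
        rw [hu, show f (Fin.insertNth 0 a r) - f (Fin.insertNth 0 a (update r j v))
          = (f (Fin.insertNth 0 a r) - f (Fin.insertNth 0 v r))
            + (f (Fin.insertNth 0 v r) - f (Fin.insertNth j.succ v r))
            + (f (Fin.insertNth j.castSucc (r j) (update r j v)) - f (Fin.insertNth 0 (r j) (update r j v)))
            + (f (Fin.insertNth 0 (r j) (update r j v)) - f (Fin.insertNth 0 a (update r j v))) by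
              rw [hrot]; ring]
        have h := mul_le_mul_of_nonneg_left (Literature.NumberTheory.Sieve.MatomakiRadziwillThm3.sq_add_four_le
          (f (Fin.insertNth 0 a r) - f (Fin.insertNth 0 v r))
          (f (Fin.insertNth 0 v r) - f (Fin.insertNth j.succ v r))
          (f (Fin.insertNth j.castSucc (r j) (update r j v)) - f (Fin.insertNth 0 (r j) (update r j v)))
          (f (Fin.insertNth 0 (r j) (update r j v)) - f (Fin.insertNth 0 a (update r j v)))) hw
        linarith [h]
      -- leg 2 is the descending arm
      have hleg2 : ∑ r : Fin K → J, ∑ a : J, ∑ v : J, ν 0 a * Tl r * ν j.succ v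
          * (f (Fin.insertNth 0 v r) - f (Fin.insertNth j.succ v r)) ^ 2 = A j.succ j.succ := by
        simp only [hAdef]
        refine sum_congr rfl fun r _ => ?_
        rw [sum_comm]
        refine sum_congr rfl fun v _ => ?_
        rw [show ∑ a : J, ν 0 a * Tl r * ν j.succ v * (f (Fin.insertNth 0 v r) - f (Fin.insertNth j.succ v r)) ^ 2
          = (∑ a : J, ν 0 a) * (Tl r * ν j.succ v
            * (f (Fin.insertNth 0 v r) - f (Fin.insertNth j.succ v r)) ^ 2) by
            rw [sum_mul]; exact sum_congr rfl fun a _ => by ring, hν1 0, one_mul]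
      -- leg 3 is the ascending arm, after the involution
      have hleg3 : ∑ r : Fin K → J, ∑ a : J, ∑ v : J, ν 0 a * Tl r * ν j.succ v
          * (f (Fin.insertNth j.castSucc (r j) (update r j v)) - f (Fin.insertNth 0 (r j) (update r j v))) ^ 2
          = A j.castSucc j.succ := by
        simp only [hAdef]
        have e1 : ∀ r : Fin K → J, ∑ a : J, ∑ v : J, ν 0 a * Tl r * ν j.succ v
            * (f (Fin.insertNth j.castSucc (r j) (update r j v)) - f (Fin.insertNth 0 (r j) (update r j v))) ^ 2
            = ∑ v : J, Tl (update r j v) * ν j.succ (r j)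
              * (f (Fin.insertNth 0 (r j) (update r j v))
                - f (Fin.insertNth j.castSucc (r j) (update r j v))) ^ 2 := by
          intro r
          rw [sum_comm]
          refine sum_congr rfl fun v _ => ?_
          rw [show ∑ a : J, ν 0 a * Tl r * ν j.succ v
            * (f (Fin.insertNth j.castSucc (r j) (update r j v)) - f (Fin.insertNth 0 (r j) (update r j v))) ^ 2
            = (∑ a : J, ν 0 a) * ((Tl r * ν j.succ v)
              * (f (Fin.insertNth j.castSucc (r j) (update r j v))
                - f (Fin.insertNth 0 (r j) (update r j v))) ^ 2) by
              rw [sum_mul]; exact sum_congr rfl fun a _ => by ring, hν1 0, one_mul, hwid r v]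
          ring
        rw [sum_congr rfl fun r _ => e1 r]
        exact sum_update_swap_eq j (fun r' o' => Tl r' * ν j.succ o'
          * (f (Fin.insertNth 0 o' r') - f (Fin.insertNth j.castSucc o' r')) ^ 2)
      -- leg 4 is the source again, after the involution
      have hleg4 : ∑ r : Fin K → J, ∑ a : J, ∑ v : J, ν 0 a * Tl r * ν j.succ v
          * (f (Fin.insertNth 0 (r j) (update r j v)) - f (Fin.insertNth 0 a (update r j v))) ^ 2
          = S j.succ := by
        simp only [hSdef]
        have e1 : ∀ r : Fin K → J, ∑ a : J, ∑ v : J, ν 0 a * Tl r * ν j.succ v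
            * (f (Fin.insertNth 0 (r j) (update r j v)) - f (Fin.insertNth 0 a (update r j v))) ^ 2
            = ∑ v : J, ∑ a : J, ν 0 a * Tl (update r j v) * ν j.succ (r j)
              * (f (Fin.insertNth 0 a (update r j v)) - f (Fin.insertNth 0 (r j) (update r j v))) ^ 2 := by
          intro r
          rw [sum_comm]
          refine sum_congr rfl fun v _ => sum_congr rfl fun a _ => ?_
          rw [mul_assoc (ν 0 a), hwid r v, ← mul_assoc]
          ring
        rw [sum_congr rfl fun r _ => e1 r]
        rw [sum_update_swap_eq j (fun r' o' => ∑ a : J, ν 0 a * Tl r' * ν j.succ o'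
          * (f (Fin.insertNth 0 a r') - f (Fin.insertNth 0 o' r')) ^ 2)]
        exact sum_congr rfl fun r _ => sum_comm
      -- assembling the level
      have hj1 : j.castSucc ≤ j.succ := (Fin.castSucc_lt_succ (i := j)).le
      calc (1 / 2) * ∑ r : Fin K → J, ∑ a : J, ∑ v : J, ν 0 a * Tl r * ν j.succ v
            * (f (Fin.insertNth 0 a r) - f (update (Fin.insertNth 0 a r : Fin (K + 1) → J) j.succ v)) ^ 2
          ≤ (1 / 2) * ∑ r : Fin K → J, ∑ a : J, ∑ v : J,
              (4 * (ν 0 a * Tl r * ν j.succ v * (f (Fin.insertNth 0 a r) - f (Fin.insertNth 0 v r)) ^ 2)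
              + 4 * (ν 0 a * Tl r * ν j.succ v
                * (f (Fin.insertNth 0 v r) - f (Fin.insertNth j.succ v r)) ^ 2)
              + 4 * (ν 0 a * Tl r * ν j.succ v
                * (f (Fin.insertNth j.castSucc (r j) (update r j v))
                  - f (Fin.insertNth 0 (r j) (update r j v))) ^ 2)
              + 4 * (ν 0 a * Tl r * ν j.succ v
                * (f (Fin.insertNth 0 (r j) (update r j v)) - f (Fin.insertNth 0 a (update r j v))) ^ 2)) :=
            mul_le_mul_of_nonneg_left (sum_le_sum fun r _ => sum_le_sum fun a _ => sum_le_sum fun v _ =>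
              hpt r a v) (by norm_num)
        _ = (1 / 2) * (4 * S j.succ + 4 * A j.succ j.succ + 4 * A j.castSucc j.succ + 4 * S j.succ) := by
            congr 1
            simp only [sum_add_distrib, ← mul_sum]
            rw [hleg2, hleg3, hleg4]
        _ ≤ (1 / 2) * (4 * (2 / (p * ρ * θ) * R) + 4 * ((K : ℝ) * U / (p * κ) * T)
              + 4 * ((K : ℝ) * U / (p * κ) * T) + 4 * (2 / (p * ρ * θ) * R)) := by
            have := hS j.succ
            have := hAK j.succ j.succ le_rfl
            have := hAK j.castSucc j.succ hj1
            refine mul_le_mul_of_nonneg_left ?_ (by norm_num)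
            linarith
        _ = 8 / (p * ρ * θ) * R + 4 * K * U / (p * κ) * T := by ring
  -- summing over the levels
  have hVar : lawVariance (tensorFun ν) f ≤ (K + 1) * (8 / (p * ρ * θ) * R + 4 * K * U / (p * κ) * T) := by
    calc lawVariance (tensorFun ν) f
        ≤ ∑ k : Fin (K + 1), (1 / 2) * ∑ z : Fin (K + 1) → J, ∑ v,
            tensorFun ν z * ν k v * (f z - f (update z k v)) ^ 2 := efronStein_tensorFun hν0 hν1 f
      _ ≤ ∑ k : Fin (K + 1), (8 / (p * ρ * θ) * R + 4 * K * U / (p * κ) * T) := sum_le_sum fun k _ => hk k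
      _ = (K + 1) * (8 / (p * ρ * θ) * R + 4 * K * U / (p * κ) * T) := by
          rw [sum_const, card_univ, Fintype.card_fin, nsmul_eq_mul]
          push_cast
          ring
  -- the two budget constraints
  have k1 : C * ((K + 1) * (4 * K * U / (p * κ) * T)) ≤ T / 4 := by
    have e1 : C * ((K + 1) * (4 * K * U / (p * κ) * T)) = (C * (16 * K * (K + 1) * U)) / (p * κ) * (T / 4) := by
      field_simp
      ring
    rw [e1]
    have : (C * (16 * K * (K + 1) * U)) / (p * κ) ≤ 1 := by rw [div_le_one hpκ]; exact hC1
    nlinarith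
  have k2 : C * ((K + 1) * (8 / (p * ρ * θ) * R)) ≤ R / 2 := by
    have e2 : C * ((K + 1) * (8 / (p * ρ * θ) * R)) = (C * (16 * (K + 1))) / (p * ρ * θ) * (R / 2) := by
      field_simp
      ring
    rw [e2]
    have : (C * (16 * (K + 1))) / (p * ρ * θ) ≤ 1 := by rw [div_le_one hall]; exact hC2
    nlinarith
  calc C * lawVariance (tensorFun ν) f
      ≤ C * ((K + 1) * (8 / (p * ρ * θ) * R + 4 * K * U / (p * κ) * T)) := mul_le_mul_of_nonneg_left hVar hC0
    _ = C * ((K + 1) * (8 / (p * ρ * θ) * R)) + C * ((K + 1) * (4 * K * U / (p * κ) * T)) := by ring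
    _ ≤ R / 2 + T / 4 := add_le_add k2 k1
    _ ≤ dirichletForm (tensorFun ν) Q f := by linarith [hTle, hRle]

/-- **THE CONVEYOR POINCARÉ INEQUALITY UNDER ONE-LEVEL GROWTH** (`U = M^K`): with `ν_{l+1}(j) ≤ M·ν_l(j)` (`1 ≤ M`) in
place of the block-heating factor, `C·Var_{ν⊗}(f) ≤ 𝓔_{ν⊗}(Q; f)` for every `C ≥ 0` with `C·16K(K+1)M^K ≤ pκ` and
`C·16(K+1) ≤ pρθ`.  Labels that only decay towards the cold end have `M = 1`. [ours] -/
theorem conveyor_poincare_of_growth (hν0 : ∀ k j, 0 ≤ ν k j) (hν1 : ∀ k, ∑ j, ν k j = 1) {p M κ ρ θ : ℝ}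
    (hp : 0 < p) (hM1 : 1 ≤ M) (hκ : 0 < κ) (hρ : 0 < ρ) (hθ : 0 < θ)
    (hpers : ∀ (i k : Fin (K + 1)) (j : J), i ≤ k → p * ν k j ≤ ν i j)
    (hM : ∀ (l : Fin K) (j : J), ν l.succ j ≤ M * ν l.castSucc j) (hQ0 : ∀ z y, 0 ≤ Q z y)
    (hT : ∀ (z : Fin (K + 1) → J) (l : Fin K), z ∘ Equiv.swap l.castSucc l.succ ≠ z →
      κ * min (tensorFun ν z) (tensorFun ν (z ∘ Equiv.swap l.castSucc l.succ))
        ≤ tensorFun ν z * Q z (z ∘ Equiv.swap l.castSucc l.succ))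
    {Q₀ : Matrix J J ℝ} (hρvar : ∀ h : J → ℝ, ρ * lawVariance (ν 0) h ≤ dirichletForm (ν 0) Q₀ h)
    (hR : ∀ (z : Fin (K + 1) → J) (v : J), v ≠ z 0 →
      θ * (tensorFun ν z * Q₀ (z 0) v) ≤ tensorFun ν z * Q z (update z 0 v))
    (f : (Fin (K + 1) → J) → ℝ) {C : ℝ} (hC0 : 0 ≤ C) (hC1 : C * (16 * K * (K + 1) * M ^ K) ≤ p * κ)
    (hC2 : C * (16 * (K + 1)) ≤ p * ρ * θ) :
    C * lawVariance (tensorFun ν) f ≤ dirichletForm (tensorFun ν) Q f :=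
  conveyor_poincare_rot hν0 hν1 hp (pow_pos (lt_of_lt_of_le one_pos hM1) K) hκ hρ hθ hpers
    (prod_succ_le_growth hν0 hM1 hM) hQ0 hT hρvar hR f hC0 hC1 hC2

/-- **THE CONVEYOR POINCARÉ INEQUALITY UNDER LEVELWISE GROWTH** (`U = Π_l M_l`): with `ν_{l+1}(j) ≤ M_l·ν_l(j)`
(`1 ≤ M_l`), `C·Var_{ν⊗}(f) ≤ 𝓔_{ν⊗}(Q; f)` for every `C ≥ 0` with `C·16K(K+1)Π_lM_l ≤ pκ` and `C·16(K+1) ≤ pρθ` —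
uneven ladders pay each level's growth once, not the worst level's growth `K` times. [ours] -/
theorem conveyor_poincare_of_levelGrowth (hν0 : ∀ k j, 0 ≤ ν k j) (hν1 : ∀ k, ∑ j, ν k j = 1) {p κ ρ θ : ℝ}
    {Mg : Fin K → ℝ} (hp : 0 < p) (hM1 : ∀ l, 1 ≤ Mg l) (hκ : 0 < κ) (hρ : 0 < ρ) (hθ : 0 < θ)
    (hpers : ∀ (i k : Fin (K + 1)) (j : J), i ≤ k → p * ν k j ≤ ν i j)
    (hM : ∀ (l : Fin K) (j : J), ν l.succ j ≤ Mg l * ν l.castSucc j) (hQ0 : ∀ z y, 0 ≤ Q z y)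
    (hT : ∀ (z : Fin (K + 1) → J) (l : Fin K), z ∘ Equiv.swap l.castSucc l.succ ≠ z →
      κ * min (tensorFun ν z) (tensorFun ν (z ∘ Equiv.swap l.castSucc l.succ))
        ≤ tensorFun ν z * Q z (z ∘ Equiv.swap l.castSucc l.succ))
    {Q₀ : Matrix J J ℝ} (hρvar : ∀ h : J → ℝ, ρ * lawVariance (ν 0) h ≤ dirichletForm (ν 0) Q₀ h)
    (hR : ∀ (z : Fin (K + 1) → J) (v : J), v ≠ z 0 →
      θ * (tensorFun ν z * Q₀ (z 0) v) ≤ tensorFun ν z * Q z (update z 0 v))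
    (f : (Fin (K + 1) → J) → ℝ) {C : ℝ} (hC0 : 0 ≤ C) (hC1 : C * (16 * K * (K + 1) * ∏ l, Mg l) ≤ p * κ)
    (hC2 : C * (16 * (K + 1)) ≤ p * ρ * θ) :
    C * lawVariance (tensorFun ν) f ≤ dirichletForm (tensorFun ν) Q f :=
  conveyor_poincare_rot hν0 hν1 hp (prod_pos fun l _ => lt_of_lt_of_le one_pos (hM1 l)) hκ hρ hθ hpers
    (prod_succ_le_levelGrowth hν0 hM1 hM) hQ0 hT hρvar hR f hC0 hC1 hC2

end Rotation

end Summit.Ventures.LatticeQCDFlow.Scaling
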